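import Mathlib.RingTheory.Jacobson.Ring
import Mathlib.NumberTheory.NumberField.Basic
import Literature.Computability.AlgebraicComplexity.ValiantClasses
import Literature.Computability.AlgebraicComplexity.StandardFamilies
import Literature.Computability.AlgebraicComplexity.DeterminantalIdealComplexityDescent
import HarnessLib

/-!
# TwoAdicLadder — crux `TwoIntegralNormalisation` (stmt-ValiantsHypothesis-5947), line `birth`:
# stub `stub_algConst` (the constants of an optimal circuit for `per_n` may be taken in a number field)

Route `ValiantsHypothesis/TwoAdicLadder`, crux `TwoIntegralNormalisation`, registered line
`Cruxes/TwoIntegralNormalisation/Lines/birth.lean`. This file proves the line's classical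
normalisation stub, verbatim:

* `stub_algConst` — if `per` is p-computable over `ℂ` then there is `a` such that for every `n` some
  number field `K` has `L_K(per_n) ≤ n^a + a`.

Proof (Bürgisser 2000, §4.1): an optimal fan-in-two `ℂ`-circuit `P` for `per_n` has finitely many
constants; they generate a finitely generated `ℚ`-subalgebra `B ⊆ ℂ`, and `P` restricts to a
circuit over `B` computing `per_n` over `B` (tree `ArithCircuit.map_mapConsts_eq_self`,
`eval_map_apply`, injectivity of `MvPolynomial.map` along `B ⊆ ℂ`). For a maximal ideal `𝔪 ⊆ B`
the field `K = B ⧸ 𝔪` is finitely generated over `ℚ`, hence a number field (Zariski's lemma,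
Mathlib `finite_of_finite_type_of_isJacobsonRing`), and mapping the circuit along `B → K` computes
`per_n` over `K` with the same size (`map_perPoly`, `ArithCircuit.size_map`).

Honest framing: a bookkeeping stub; the load-bearing stub of the line (`stub_halfElim`) and the crux
stay open; VP ≠ VNP is NOT proved here.
-/

noncomputable section

open MvPolynomial

-- the summit and the problem share the name `ValiantsHypothesis` (D-0017 single-conjunct layout)
set_option linter.dupNamespace false

namespace Summit.ValiantsHypothesis.ValiantsHypothesis.Theorems.TwoAdicLadder.TwoIntegralNormalisation

open Literature.Computability.AlgebraicComplexity

/-- **Descent of one circuit to a number field.** A fan-in-two `ℂ`-circuit `P` computing `per_n`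
yields a number field `K` with `L_K(per_n) ≤ P.size` (restrict to the `ℚ`-algebra generated by the
constants, then reduce modulo a maximal ideal; Zariski's lemma). [cite: Burgisser2000, §4.1] -/
theorem exists_numberField_complexity_perPoly_le (n : ℕ) (P : ArithCircuit ℂ (Fin n × Fin n))
    (hP2 : P.IsFanInTwo) (hPf : P.Computes (perPoly (Fin n) ℂ)) :
    ∃ (K : Type) (_ : Field K) (_ : NumberField K), complexity (perPoly (Fin n) K) ≤ P.size := by
  classical
  -- the `ℚ`-subalgebra generated by the constants of `P`
  set B : Subalgebra ℚ ℂ := Algebra.adjoin ℚ (↑P.consts.toFinset : Set ℂ) with hB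
  have hPc : ∀ c ∈ P.consts, c ∈ B := fun c hc =>
    Algebra.subset_adjoin (List.mem_toFinset.2 hc)
  haveI : Algebra.FiniteType ℚ B :=
    (Subalgebra.fg_iff_finiteType _).1 (Subalgebra.fg_adjoin_finset P.consts.toFinset)
  -- restriction of `P` to `B`
  let ι : B →+* ℂ := (B.val : B →ₐ[ℚ] ℂ).toRingHom
  have hι : Function.Injective ι := Subtype.val_injective
  let ρ : ℂ → B := fun x => if hx : x ∈ B then ⟨x, hx⟩ else 0
  set P₀ : ArithCircuit B (Fin n × Fin n) := P.mapConsts ρ with hP₀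
  have hP₀map : P₀.map ι = P :=
    ArithCircuit.map_mapConsts_eq_self ρ ι P fun c hc => by
      simp only [ρ, dif_pos (hPc c hc)]; rfl
  have hP₀f : P₀.Computes (perPoly (Fin n) B) := by
    have hev := ArithCircuit.eval_map_apply ι P₀
    rw [hP₀map] at hev
    unfold ArithCircuit.Computes at hPf ⊢
    apply MvPolynomial.map_injective ι hι
    rw [← hev, hPf, map_perPoly]
  -- a maximal ideal of `B` and the number field `B ⧸ 𝔪`
  obtain ⟨𝔪, h𝔪⟩ := Ideal.exists_maximal B
  haveI : Algebra.FiniteType ℚ (B ⧸ 𝔪) := inferInstance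
  -- record the `ℚ`-module structure of the quotient algebra (the number-field structure below uses
  -- `DivisionRing.toRatAlgebra`; `ℚ`-module structures form a subsingleton)
  let modQ : Module ℚ (B ⧸ 𝔪) := inferInstance
  letI : Field (B ⧸ 𝔪) := Ideal.Quotient.field 𝔪
  have hfin : @Module.Finite ℚ (B ⧸ 𝔪) _ _ modQ := finite_of_finite_type_of_isJacobsonRing ℚ (B ⧸ 𝔪)
  haveI : CharZero (B ⧸ 𝔪) := charZero_of_injective_algebraMap (algebraMap ℚ (B ⧸ 𝔪)).injective
  haveI : NumberField (B ⧸ 𝔪) := by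
    refine @NumberField.mk _ _ _ ?_
    have e : modQ = @Algebra.toModule ℚ (B ⧸ 𝔪) _ _ DivisionRing.toRatAlgebra := Subsingleton.elim _ _
    unfold FiniteDimensional
    rw [← e]
    exact hfin
  -- the circuit over `B ⧸ 𝔪`
  let π : B →+* B ⧸ 𝔪 := Ideal.Quotient.mk 𝔪
  refine ⟨B ⧸ 𝔪, inferInstance, inferInstance, ?_⟩
  have hcomp : (P₀.map π).Computes (perPoly (Fin n) (B ⧸ 𝔪)) := by
    have := hP₀f.map π
    rwa [map_perPoly] at this
  calc complexity (perPoly (Fin n) (B ⧸ 𝔪)) ≤ (P₀.map π).size :=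
        ArithCircuit.complexity_le_size ((hP2.mapConsts ρ).map π) hcomp
    _ = P.size := by rw [ArithCircuit.size_map, hP₀, ArithCircuit.size_mapConsts]

/-- **Stub `AlgConst`** (registered obligation `stub_algConst` of crux `TwoIntegralNormalisation`,
line `birth`; signature verbatim): if the permanent family is p-computable over `ℂ`, then for one
exponent `a` and every `n` some number field `K` has `L_K(per_n) ≤ n ^ a + a` (the optimal
`ℂ`-circuit is defined over the finitely generated `ℚ`-algebra of its constants, which maps onto a
number field). [cite: Burgisser2000, §4.1] -/
theorem stub_algConst :
    IsPComputable (fun n => perPoly (Fin n) ℂ) →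
      ∃ a : ℕ, ∀ n : ℕ, ∃ (K : Type) (_ : Field K) (_ : NumberField K),
        complexity (perPoly (Fin n) K) ≤ n ^ a + a := by
  rintro ⟨a, ha⟩
  refine ⟨a, fun n => ?_⟩
  obtain ⟨P, hP2, hPf, hsize⟩ := ArithCircuit.exists_computes_size_eq_complexity (perPoly (Fin n) ℂ)
  obtain ⟨K, hK, hKN, hle⟩ := exists_numberField_complexity_perPoly_le n P hP2 hPf
  exact ⟨K, hK, hKN, hle.trans (hsize ▸ ha n)⟩

end Summit.ValiantsHypothesis.ValiantsHypothesis.Theorems.TwoAdicLadder.TwoIntegralNormalisation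

end
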